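import Summits.Ventures.PercRepro.RankLevelSetLevelSixHeavyCellSq27DI
import Summits.Ventures.PercRepro.RankLevelSetLevelSixCapGlue25
import Summits.Ventures.PercRepro.TriangleCapEightI
import Summits.Ventures.PercRepro.S1TrianglePlusSharp
import Summits.Ventures.PercRepro.S1SeriesLever14
import Summits.Ventures.PercRepro.RankLevelSetLevelSixHeavyCellSq27DI2
import Summits.Ventures.PercRepro.RankLevelSetLevelSixHeavyCellSq27DI3
import Summits.Ventures.PercRepro.RankLevelSetLevelSixArithHeavySq25DI2A
import Summits.Ventures.PercRepro.RankLevelSetLevelSixArithHeavySq25DI3A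
import Summits.Ventures.PercRepro.MatroidColoopStepA

/-!
# PercRepro — THE 25 ROW, THE PARITY CELL `(p ≥ 25, 24)`: COLOOP-FREE ON THE DI2 CELL, WITH A COLOOP ON THE DI3 CELL (p8 g9, S3)

`proofs/SUBCLAIM-S3-p8.md` §3w (THE 25 ROW). The parity cell `n = 2d + 1 = 49` (`Σ_{j ≤ 24} C(49, j) = 2^48` exactly) is the one cell of the row where the nullity-only recipe fails (`1.0109`); coloop-free it closes on the DI2 cell with the 6- and 7-circuit steps (`0.99966`), and WITH A COLOOP the spanning count drops to `Σ_{j ≤ 24} C(48, j)` (`0.808`). Axioms: standard.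
-/

open scoped Matroid

namespace PercRepro

namespace ThmN

open Set

variable {α : Type}

/-- **A core with a coloop has few spanning sets**: every spanning set of `M` contains the coloop `e`, so
`#span(M) = #span(M ∖ e) ≤ Σ_{j ≤ d} C(|E| − 1, j)` (`levelCount_succ_eq_of_isColoop`, the level `p + 1` of `M ∖ e` is empty,
`ncard_spanning_le` on `M ∖ e` at corank `d`). -/
theorem ncard_spanning_le_of_isColoop (M : Matroid α) [M.Finite] {e : α} (he : M.IsColoop e) {p d : ℕ}
    (hR : M.eRank = ((p + 1 : ℕ) : ℕ∞)) (hn : M.E.ncard = p + 1 + d) :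
    {X : Set α | X ⊆ M.E ∧ M.eRk X = M.eRank}.ncard ≤ ∑ j ∈ Finset.range (d + 1), (p + d).choose j := by
  have h1 : {X : Set α | X ⊆ M.E ∧ M.eRk X = M.eRank}.ncard = Matroid.levelCount M (p + 1) := by
    unfold Matroid.levelCount; rw [hR]
  rw [h1, Matroid.levelCount_succ_eq_of_isColoop he p]
  have hR' : (M ＼ {e}).eRank = ((p : ℕ) : ℕ∞) := Matroid.eRank_delete_eq he hR
  have h0 : Matroid.levelCount (M ＼ {e}) (p + 1) = 0 :=
    Matroid.levelCount_eq_zero_of_eRank_lt (by rw [hR']; exact_mod_cast Nat.lt_succ_self p)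
  rw [h0, zero_add]
  have hn' : (M ＼ {e}).E.ncard = p + d := by
    rw [Matroid.delete_singleton_ground, Set.ncard_sdiff_singleton_of_mem he.mem_ground, hn]
    omega
  have hd' : (M ＼ {e}).E.encard = (M ＼ {e}).eRank + d := by
    rw [hR', ← (M ＼ {e}).ground_finite.cast_ncard_eq, hn']
    push_cast; ring
  have hB := Matroid.ncard_spanning_le (M := M ＼ {e}) hd'
  have hcard : (M ＼ {e}).ground_finite.toFinset.card = p + d := by
    rw [← Set.ncard_eq_toFinset_card _ (M ＼ {e}).ground_finite]; exact hn'
  rw [hcard] at hB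
  unfold Matroid.levelCount
  rw [← hR']
  exact hB


/-- **THE PARITY CELL `(p ≥ 25, 24)`, COLOOP-FREE** (the DI2 cell `c025_core_six_heavy_cell_sq27di2` with ArithHeavySq25DI2A: the coloop-free caps with `m = 49` — the triangle step, `gb14 24 49 = 2479`, the steps on `avgChain5c 23`, `C(28, 6)`, `C(29, 7)`; `K = 1999`, `0.99966`). -/
theorem c025_core_six_parity_heavy_sq25_free (M : Matroid α) [M.Finite] (p d : ℕ) (hp : 25 ≤ p) (hd24 : d = 24) (hcf : ∀ e ∈ M.E, ¬ M.IsColoop e)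
    (hR : M.eRank = (p : ℕ∞)) (hn : M.E.ncard = p + d)
    (hfree : ∀ e ∈ M.E, ∃ A ⊆ M.E \ {e}, e ∉ M.closure A ∧ e ∉ M.closure ((M.E \ {e}) \ A)) :
    RLS M p 6 := by
  have hd : M.E.encard = M.eRank + d := by
    rw [hR, ← M.ground_finite.cast_ncard_eq, hn]
    push_cast
    ring
  have hL : ∀ e ∈ M.E, ¬ M.IsLoop e := not_isLoop_of_free M hfree
  have hs : ∀ e ∈ M.E, ∀ f ∈ M.E, e ≠ f → M.eRk {e, f} = 2 := by
    intro e he f hf hef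
    have h2 : (2 : ℕ∞) ≤ M.eRk {e, f} :=
      two_le_eRk_of_two_le_ncard_of_free M hfree (pair_subset he hf) (by rw [ncard_pair hef])
    have h3 : M.eRk {e, f} ≤ 2 := by
      have := M.eRk_le_encard {e, f}
      rwa [encard_pair hef] at this
    exact le_antisymm h3 h2
  have hC1 : ∀ L ⊆ M.E, M.eRk L = 2 → L.ncard ≤ 3 :=
    fun L hL hr => ncard_le_three_of_eRk_two M hs hfree hL hr
  have hC2 : ∀ P ⊆ M.E, M.eRk P ≤ 3 → P.ncard ≤ 6 :=
    fun P hP hr => ncard_le_six_of_eRk_le_three_of_free M hfree hP hr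
  have hΦ : phiK p 6 ≤ (2 : ℚ) ^ (p + 6) / (((p + 6).choose 6 : ℕ) : ℚ) := phiK_le_two_pow_div_six p
  rw [RLS_iff]
  subst hd24
  exact c025_core_six_heavy_cell_sq27di2 M p 24 19 1 1 35 0 1 1999 1000 30 49718 2479 139 429308 1820910
      ((p + 6).choose 6) (Nat.choose_pos (by omega)) (phiK p 6) hΦ (by norm_num) (by omega)
      (by norm_num) (by norm_num) (by norm_num) (by norm_num) (by norm_num)
      (by norm_num [cnull]) (by norm_num [cnull]) (Or.inl (by norm_num)) (Or.inr (Or.inr (by norm_num))) (Or.inr rfl) (by norm_num) (by norm_num) (by norm_num)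
      (s3_cf_of M hfree hcf (d := 23) (by simpa using hd) 49 139 (by norm_num) (by omega) (by norm_num [TriangleCap.cq3]) (by norm_num [TriangleCap.cq3]) (by norm_num [TriangleCap.cq3]))
      ((S1.ncard_fourCircuits_le_gb14 24 M hfree hd 49 (by rw [coloops_eq_empty_of_forall M hcf, Set.sdiff_empty, hn]; omega)).trans (by decide))
      (s5_cf_of M hfree hcf (d := 23) (by rw [hd]; norm_num) 49 44645 49718 (by norm_num) (by omega) (by decide) (by omega))
      (s6_cf_of M hfree hcf (d := 23) (by rw [hd]; norm_num) 49 376740 429308 (by norm_num) (by omega) (by norm_num [Nat.choose]) (by omega))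
      (s7_cf_of M hfree hcf (d := 23) (by rw [hd]; norm_num) 49 1560780 1820910 (by norm_num) (by omega) (by norm_num [Nat.choose]) (by omega))
      (Or.inl (tail_six_heavy_sq25DI2_24 p hp)) hR hn hfree (level_six_poly_heavy_sq25DI2_24 p hp)
/-- **THE PARITY CELL `(p ≥ 25, 24)` WITH A COLOOP** (the DI3 cell `c025_core_six_heavy_cell_sq27di3` with ArithHeavySq25DI3A: the spanning count `#span(M) ≤ Σ_{j ≤ 24} C(n − 1, j)` of `ncard_spanning_le_of_isColoop` — every spanning set contains the coloop — and the nullity-only caps; `K = 3586`, `0.808`). -/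
theorem c025_core_six_parity_heavy_sq25_coloop (M : Matroid α) [M.Finite] (p d : ℕ) (hp : 25 ≤ p) (hd24 : d = 24) {e : α} (he : M.IsColoop e)
    (hR : M.eRank = (p : ℕ∞)) (hn : M.E.ncard = p + d)
    (hfree : ∀ e ∈ M.E, ∃ A ⊆ M.E \ {e}, e ∉ M.closure A ∧ e ∉ M.closure ((M.E \ {e}) \ A)) :
    RLS M p 6 := by
  have hd : M.E.encard = M.eRank + d := by
    rw [hR, ← M.ground_finite.cast_ncard_eq, hn]
    push_cast
    ring
  have hL : ∀ e ∈ M.E, ¬ M.IsLoop e := not_isLoop_of_free M hfree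
  have hs : ∀ e ∈ M.E, ∀ f ∈ M.E, e ≠ f → M.eRk {e, f} = 2 := by
    intro e he f hf hef
    have h2 : (2 : ℕ∞) ≤ M.eRk {e, f} :=
      two_le_eRk_of_two_le_ncard_of_free M hfree (pair_subset he hf) (by rw [ncard_pair hef])
    have h3 : M.eRk {e, f} ≤ 2 := by
      have := M.eRk_le_encard {e, f}
      rwa [encard_pair hef] at this
    exact le_antisymm h3 h2
  have hC1 : ∀ L ⊆ M.E, M.eRk L = 2 → L.ncard ≤ 3 :=
    fun L hL hr => ncard_le_three_of_eRk_two M hs hfree hL hr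
  have hC2 : ∀ P ⊆ M.E, M.eRk P ≤ 3 → P.ncard ≤ 6 :=
    fun P hP hr => ncard_le_six_of_eRk_le_three_of_free M hfree hP hr
  subst hd24
  obtain ⟨p', rfl⟩ : ∃ p', p = p' + 1 := ⟨p - 1, by omega⟩
  have hΦ : phiK (p' + 1) 6 ≤ (2 : ℚ) ^ (p' + 1 + 6) / (((p' + 1 + 6).choose 6 : ℕ) : ℚ) := phiK_le_two_pow_div_six (p' + 1)
  rw [RLS_iff]
  have hsp : ({X : Set α | X ⊆ M.E ∧ M.eRk X = M.eRank}.ncard : ℚ) ≤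
      ∑ j ∈ Finset.range (24 + 1), (((p' + 1 + 24 - 1).choose j : ℕ) : ℚ) := by
    have h := ncard_spanning_le_of_isColoop M he hR (by rw [hn])
    rw [show p' + 1 + 24 - 1 = p' + 24 by omega]
    exact_mod_cast h
  exact c025_core_six_heavy_cell_sq27di3 M (p' + 1) 24 18 1 1 36 0 1 3586 1000 30 53946 2874 146
      ((p' + 1 + 6).choose 6) (Nat.choose_pos (by omega)) (phiK (p' + 1) 6) hΦ (by norm_num) (by omega) (∑ j ∈ Finset.range (24 + 1), (((p' + 1 + 24 - 1).choose j : ℕ) : ℚ)) hsp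
      (by norm_num) (by norm_num) (by norm_num) (by norm_num) (by norm_num)
      (by norm_num [cnull]) (by norm_num [cnull]) (Or.inl (by norm_num)) (Or.inr (Or.inr (by norm_num))) (Or.inr rfl) (by norm_num) (by norm_num) (by norm_num)
      ((TriangleCap.core_ncard_triangles_le_cq3 M hfree hd).trans (by decide))
      ((ncard_fourCircuits_le_avgChain14 24 M hfree hd).trans (by decide))
      ((S1.ncard_fiveCircuits_le_avgChain5c 24 M hfree hd).trans (by decide))
      (tail_six_heavy_sq25DI3_24 (p' + 1) hp) hR hn hfree (level_six_poly_heavy_sq25DI3_24 (p' + 1) hp)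
/-- **THE PARITY CELL `(p ≥ 25, 24)`, every `e`-free core** (a coloop or none). -/
theorem c025_core_six_parity_heavy_sq25 (M : Matroid α) [M.Finite] (p : ℕ) (hp : 25 ≤ p)
    (hR : M.eRank = (p : ℕ∞)) (hn : M.E.ncard = p + 24)
    (hfree : ∀ e ∈ M.E, ∃ A ⊆ M.E \ {e}, e ∉ M.closure A ∧ e ∉ M.closure ((M.E \ {e}) \ A)) : RLS M p 6 := by
  by_cases hc : ∃ e ∈ M.E, M.IsColoop e
  · obtain ⟨e, _, hce⟩ := hc
    exact c025_core_six_parity_heavy_sq25_coloop M p 24 hp rfl hce hR hn hfree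
  · exact c025_core_six_parity_heavy_sq25_free M p 24 hp rfl (fun e he hce => hc ⟨e, he, hce⟩) hR hn hfree
end ThmN

end PercRepro
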